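import Summits.QuantumFields.YangMills.Theorems.AlphaInputsT3ACv3LinearLiftFluxCombine
import HarnessLib

/-!
# `AlphaInputsT3ACv3LinearLiftFluxSupplier` — «FLUX-COMBINE» MAIN: the flux-sector fine one-form, packaged — cell `ym3-torus`, width seat `ym-ust-20520-w5` (g8), line «SYM-CENTRE»
# (EX cure (ii-a)); composes ✓FLUX-ROUND ∘ ✓ZCLASS ∘ ✓`exists_fluxLift_real` ∘ ✓`two_pi_abs_q_le` ∘ ★px19's ✓`exists_smoothExactLift_torus`

WHAT.  ★★★`exists_flux_combine`: on a torus whose directions are exhausted by three pairwise distinct `e₀ e₁ e₂` (T³: `0 1 2`), level `k ≤ m + K`: from coarse angles `θ` and integers `m`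
with `|curl θ − 2π·m| ≤ φ₀` (`6φ₀ < 2π`) it produces an INTEGER gauge `s`, the antisymmetric class `q`, a SMOOTH fine one-form `a′` (both rows of ✓p674080 at `ε = 2φ₀`) and the fine
one-form `a := a′ − Σ_{pairs} w_{μν}` with (E) `linAvgIter k a = θ − 2π·s` EXACTLY and (F) at every level `s' ≤ k`:
`curl (linAvgIter s' a)(x;μν) = curl (linAvgIter s' a′)(x;μν) − 2π·q_{μν}·(L²)^{s'}/M₀² + 2π·q_{μν}·[x_μ = −1 ∧ x_ν = −1]` — real part = smooth + constant, integer part on the corner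
columns only.  The assembler then reads: fibre by ★w4's `diag_mem_fibre_diag_of_loopSum_T3` (loop sums via ✓`abs_loopSum_linAvgIter_le_of_curl_off_corner`), `RegPr` by
✓`regPr_gexpAt_sigma3_of_curl_rows_modZ`, `gexpAt (θ − 2πs) = gexpAt θ` by ★w4's periodicity.
HONEST FRAMING.  Composition of landed kernel facts; nothing of EX∕the crux∕`hSymCentre` proved or claimed; count-neutral helper (`--supports stmt-QuantumFields-19200 --as helper`);
def-free.  YM₃ on the torus is a RUNG (R3), not the Clay problem; no claim about d = 4, infinite volume or a mass gap.

References: T. Bałaban, Commun. Math. Phys. 109 (1987) 249–301 [Balaban1987RG1] ((0.4)+(0.11) p.253); Commun. Math. Phys. 98 (1985) 17–51 [Balaban1985Averaging] ((9), (14) p.19).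
-/

set_option autoImplicit false

noncomputable section

namespace Summit.QuantumFields.YangMills.Theorems.LinearLiftFlux

open scoped BigOperators
open Finset
open Literature.MathematicalPhysics.QuantumFieldTheory.Balaban1983to89
open Summit.QuantumFields.YangMills.Theorems.AbelianEML
open Summit.QuantumFields.YangMills.Theorems.LinearLiftSpread (linAvgIter_sub curlAt_sub hN hside)
open Summit.QuantumFields.YangMills.Theorems.LinearLiftSpreadLip (exists_smoothExactLift_torus)

variable {P : Params}

/-! ## §1 The curl of the three-pair flux sum -/

/-- **THE THREE-PAIR FLUX SUM IN STANDARD FORM**: if `w₀₁, w₀₂, w₁₂` have the standard curls of ✓`exists_fluxLift_real` with charges `r e₀ e₁, r e₀ e₂, r e₁ e₂` for an antisymmetric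
`r`, then at every site and every ordered pair `curl(w₀₁ + w₀₂ + w₁₂)(x;μν) = r μ ν·c − r μ ν·[x_μ = −1 ∧ x_ν = −1]`. [cite: Balaban1985Averaging, (9) p.19] -/
theorem curl_fluxSum {e₀ e₁ e₂ : Fin P.d} (h01 : e₀ ≠ e₁) (h02 : e₀ ≠ e₂) (h12 : e₁ ≠ e₂) (hall : ∀ κ : Fin P.d, κ = e₀ ∨ κ = e₁ ∨ κ = e₂)
    {i : ℕ} (r : Fin P.d → Fin P.d → ℝ) (hr : ∀ μ ν, r ν μ = -r μ ν) (c : ℝ) (u₀₁ u₀₂ u₁₂ : PBond P i → ℝ)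
    (h₀₁ : ∀ (x : Site P i) (κ lam : Fin P.d), curlAt u₀₁ x κ lam =
      (if κ = e₀ ∧ lam = e₁ then (1 : ℝ) else if κ = e₁ ∧ lam = e₀ then -1 else 0) * (r e₀ e₁ * (c - (if x e₀ = -1 ∧ x e₁ = -1 then 1 else 0))))
    (h₀₂ : ∀ (x : Site P i) (κ lam : Fin P.d), curlAt u₀₂ x κ lam =
      (if κ = e₀ ∧ lam = e₂ then (1 : ℝ) else if κ = e₂ ∧ lam = e₀ then -1 else 0) * (r e₀ e₂ * (c - (if x e₀ = -1 ∧ x e₂ = -1 then 1 else 0))))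
    (h₁₂ : ∀ (x : Site P i) (κ lam : Fin P.d), curlAt u₁₂ x κ lam =
      (if κ = e₁ ∧ lam = e₂ then (1 : ℝ) else if κ = e₂ ∧ lam = e₁ then -1 else 0) * (r e₁ e₂ * (c - (if x e₁ = -1 ∧ x e₂ = -1 then 1 else 0))))
    (x : Site P i) (μ ν : Fin P.d) :
    curlAt (fun b => u₀₁ b + u₀₂ b + u₁₂ b) x μ ν = r μ ν * c - r μ ν * (if x μ = -1 ∧ x ν = -1 then 1 else 0) := by
  have h10 := Ne.symm h01; have h20 := Ne.symm h02; have h21 := Ne.symm h12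
  have hdiag : ∀ κ, r κ κ = 0 := fun κ => by have := hr κ κ; linarith
  have Ecomm : ∀ κ lam : Fin P.d, (if x lam = -1 ∧ x κ = -1 then (1:ℝ) else 0) = (if x κ = -1 ∧ x lam = -1 then 1 else 0) := fun κ lam => by simp only [and_comm]
  have hsum : curlAt (fun b => u₀₁ b + u₀₂ b + u₁₂ b) x μ ν = curlAt u₀₁ x μ ν + curlAt u₀₂ x μ ν + curlAt u₁₂ x μ ν := by simp only [curlAt]; ring
  rw [hsum, h₀₁, h₀₂, h₁₂]
  rcases hall μ with hμ | hμ | hμ <;> rcases hall ν with hν | hν | hν <;> rw [hμ, hν]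
  · rw [hdiag]; simp only [h01, h02, and_false, false_and, if_false]; ring
  · simp only [h01, h02, h10, h12, and_self, and_false, false_and, if_false, if_true]; ring
  · simp only [h01, h02, h20, h21, and_self, and_false, false_and, if_false, if_true]; ring
  · rw [hr e₁ e₀, Ecomm e₀ e₁]; simp only [h01, h02, h10, h12, and_self, and_false, false_and, if_false, if_true]; ring
  · rw [hdiag]; simp only [h12, h10, and_false, false_and, if_false]; ring
  · simp only [h10, h20, h12, h21, and_self, and_false, false_and, if_false, if_true]; ring
  · rw [hr e₂ e₀, Ecomm e₀ e₂]; simp only [h01, h02, h20, h21, and_self, and_false, false_and, if_false, if_true]; ring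
  · rw [hr e₂ e₁, Ecomm e₁ e₂]; simp only [h10, h20, h12, h21, and_self, and_false, false_and, if_false, if_true]; ring
  · rw [hdiag]; simp only [h20, h21, and_false, false_and, if_false]; ring

/-! ## §2 The package -/

/-- **★★★ «FLUX-COMBINE»** — see the module docstring: integer gauge `s`, antisymmetric class `q`, smooth part `a′` with both rows of ✓`exists_smoothExactLift_torus` at `ε = 2φ₀`, and
`a := a′ − (flux sum)` with (E) `linAvgIter k a = θ − 2π·s` and (F) the level-wise curl structure. [cite: Balaban1987RG1, (0.4)+(0.11) p.253; Balaban1985Averaging, (9)+(14) p.19] -/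
theorem exists_flux_combine {e₀ e₁ e₂ : Fin P.d} (h01 : e₀ ≠ e₁) (h02 : e₀ ≠ e₂) (h12 : e₁ ≠ e₂) (hall : ∀ κ : Fin P.d, κ = e₀ ∨ κ = e₁ ∨ κ = e₂)
    (k : ℕ) (hk : k ≤ P.m + P.K) (θ : PBond P k → ℝ) (m : Site P k → Fin P.d → Fin P.d → ℤ) {φ₀ : ℝ} (hφ : 6 * φ₀ < 2 * Real.pi)
    (hnear : ∀ (y : Site P k) (μ ν : Fin P.d), |curlAt θ y μ ν - 2 * Real.pi * m y μ ν| ≤ φ₀) :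
    ∃ (s : PBond P k → ℤ) (q : Fin P.d → Fin P.d → ℤ) (a a' : PBond P 0 → ℝ),
      (∀ μ ν, q ν μ = -q μ ν) ∧
      (linAvgIter k a = fun b => θ b - 2 * Real.pi * s b) ∧
      (∀ (x : Site P 0) (μ ν : Fin P.d), μ ≠ ν → |curlAt a' x μ ν| ≤ (54 : ℝ) ^ P.d * (2 * φ₀) / ((P.L : ℝ) ^ k) ^ 2) ∧
      (∀ (x : Site P 0) (lam μ ν : Fin P.d), μ ≠ ν → |curlAt a' (x.shift lam) μ ν - curlAt a' x μ ν| ≤ 330 * (54 : ℝ) ^ (P.d - 1) * (2 * φ₀) / ((P.L : ℝ) ^ k) ^ 3) ∧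
      (∀ s', s' ≤ k → ∀ (x : Site P s') (μ ν : Fin P.d), curlAt (linAvgIter s' a) x μ ν =
        curlAt (linAvgIter s' a') x μ ν - 2 * Real.pi * q μ ν * (((P.L : ℝ) ^ 2) ^ s' * (1 / ((P.sitesPerDir 0 : ℝ)) ^ 2))
          + 2 * Real.pi * q μ ν * (if x μ = -1 ∧ x ν = -1 then 1 else 0)) := by
  have hπ := Real.pi_pos
  -- the integer part is an antisymmetric cocycle
  have hanti : ∀ x μ ν, m x ν μ = -m x μ ν := fun x μ ν => by
    have := int_antisymm_of_near_curl θ m (by linarith) x μ ν (hnear x μ ν) (hnear x ν μ); linarith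
  have hcube : ∀ x μ ν lam, (m x μ ν - m (x.shift lam) μ ν) + (m x ν lam - m (x.shift μ) ν lam) + (m x lam μ - m (x.shift ν) lam μ) = 0 :=
    fun x μ ν lam => int_cube_of_near_curl θ m hφ x μ ν lam (hnear _ _ _) (hnear _ _ _) (hnear _ _ _) (hnear _ _ _) (hnear _ _ _) (hnear _ _ _)
  -- ZCLASS
  obtain ⟨q, s, hqanti, hdec⟩ := exists_int_class_decomposition₃ h01 h02 h12 hall m hanti hcube
  -- the three flux cochains with real charges `2π q`
  set r : Fin P.d → Fin P.d → ℝ := fun μ ν => 2 * Real.pi * (q μ ν : ℝ) with hr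
  have hrant : ∀ μ ν, r ν μ = -r μ ν := fun μ ν => by simp only [hr, hqanti μ ν, Int.cast_neg]; ring
  obtain ⟨w₀₁, hw₀₁⟩ := exists_fluxLift_real k hk h01 (r e₀ e₁)
  obtain ⟨w₀₂, hw₀₂⟩ := exists_fluxLift_real k hk h02 (r e₀ e₂)
  obtain ⟨w₁₂, hw₁₂⟩ := exists_fluxLift_real k hk h12 (r e₁ e₂)
  set ws : PBond P 0 → ℝ := fun b => w₀₁ b + w₀₂ b + w₁₂ b with hws
  have hwsIter : ∀ s', linAvgIter s' ws = fun b => linAvgIter s' w₀₁ b + linAvgIter s' w₀₂ b + linAvgIter s' w₁₂ b := by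
    intro s'
    rw [hws, show (fun b => w₀₁ b + w₀₂ b + w₁₂ b) = (fun b => (fun b' => w₀₁ b' + w₀₂ b') b + w₁₂ b) from rfl, linAvgIter_add', linAvgIter_add']
  have hwscurl : ∀ s', s' ≤ k → ∀ (x : Site P s') (μ ν : Fin P.d), curlAt (linAvgIter s' ws) x μ ν =
      r μ ν * (((P.L : ℝ) ^ 2) ^ s' * (1 / ((P.sitesPerDir 0 : ℝ)) ^ 2)) - r μ ν * (if x μ = -1 ∧ x ν = -1 then 1 else 0) := by
    intro s' hs' x μ ν
    rw [hwsIter]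
    exact curl_fluxSum h01 h02 h12 hall r hrant _ _ _ _ (hw₀₁ s' hs') (hw₀₂ s' hs') (hw₁₂ s' hs') x μ ν
  -- the de-fluxed coarse angles `θ′ := θ − 2πs + W`
  set sR : PBond P k → ℝ := fun b => 2 * Real.pi * (s b : ℝ) with hsR
  set θ' : PBond P k → ℝ := fun b => θ b - sR b + linAvgIter k ws b with hθ'
  have hcurlθ' : ∀ (y : Site P k) (μ ν : Fin P.d), curlAt θ' y μ ν =
      (curlAt θ y μ ν - 2 * Real.pi * m y μ ν) + r μ ν * (((P.L : ℝ) ^ 2) ^ k * (1 / ((P.sitesPerDir 0 : ℝ)) ^ 2)) := by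
    intro y μ ν
    have e1 : curlAt θ' y μ ν = curlAt θ y μ ν - curlAt sR y μ ν + curlAt (linAvgIter k ws) y μ ν := by simp only [hθ', curlAt]; ring
    have e2 : curlAt sR y μ ν = 2 * Real.pi * ((s ⟨y, μ⟩ : ℝ) + s ⟨y.shift μ, ν⟩ - s ⟨y.shift ν, μ⟩ - s ⟨y, ν⟩) := by simp only [hsR, curlAt]; ring
    have e3 : (m y μ ν : ℝ) = q μ ν * (if y μ = -1 ∧ y ν = -1 then 1 else 0) + ((s ⟨y, μ⟩ : ℝ) + s ⟨y.shift μ, ν⟩ - s ⟨y.shift ν, μ⟩ - s ⟨y, ν⟩) := by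
      have := hdec y μ ν; exact_mod_cast this
    rw [e1, e2, hwscurl k le_rfl, e3]; simp only [hr]; ring
  -- smallness of the class and of `curl θ′`
  have hq : ∀ μ ν, μ ≠ ν → |r μ ν * (((P.L : ℝ) ^ 2) ^ k * (1 / ((P.sitesPerDir 0 : ℝ)) ^ 2))| ≤ φ₀ := by
    intro μ ν hμν
    have hb := two_pi_abs_q_le θ m hnear hμν (q μ ν) s (fun y => by have := hdec y μ ν; exact_mod_cast this)
    rw [pow_mul_inv_sq k hk]
    have hN : (0 : ℝ) < (P.sitesPerDir k : ℝ) := by exact_mod_cast (by have := P.one_lt_sitesPerDir k; omega)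
    rw [abs_mul, abs_of_pos (by positivity : (0:ℝ) < 1 / ((P.sitesPerDir k : ℝ)) ^ 2), hr]
    simp only
    rw [abs_mul (2 * Real.pi) ((q μ ν : ℤ) : ℝ), abs_of_pos (by positivity : (0:ℝ) < 2 * Real.pi)]
    rw [mul_one_div, div_le_iff₀ (by positivity)]
    linarith
  have hθ'small : ∀ (y : Site P k) (μ ν : Fin P.d), μ ≠ ν → |curlAt θ' y μ ν| ≤ 2 * φ₀ := by
    intro y μ ν hμν
    rw [hcurlθ']
    calc _ ≤ |curlAt θ y μ ν - 2 * Real.pi * m y μ ν| + |r μ ν * (((P.L : ℝ) ^ 2) ^ k * (1 / ((P.sitesPerDir 0 : ℝ)) ^ 2))| := abs_add_le _ _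
      _ ≤ φ₀ + φ₀ := add_le_add (hnear y μ ν) (hq μ ν hμν)
      _ = 2 * φ₀ := by ring
  -- the smooth exact lift of `θ′`
  obtain ⟨a', ha'avg, ha'1, ha'2⟩ := exists_smoothExactLift_torus k hk θ' hθ'small
  refine ⟨s, q, fun b => a' b - ws b, a', hqanti, ?_, ha'1, ha'2, ?_⟩
  · -- (E) the exact average
    have h := linAvgIter_sub a' ws k
    have e : (a' - ws : PBond P 0 → ℝ) = fun b => a' b - ws b := by funext b; rfl
    rw [e] at h
    rw [h, ha'avg]
    funext b
    simp only [Pi.sub_apply, hθ', hsR]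
    ring
  · -- (F) the level-wise curl structure
    intro s' hs' x μ ν
    have h := linAvgIter_sub a' ws s'
    have e : (a' - ws : PBond P 0 → ℝ) = fun b => a' b - ws b := by funext b; rfl
    rw [e] at h
    rw [h, curlAt_sub, hwscurl s' hs']
    simp only [hr]
    ring


/-- **★★★ «FLUX-COMBINE» WITH THE CLASS BOUND EXPORTED** (v1.1 append): the same package plus the row `2π·|q_{μν}| ≤ N_k²·φ₀` (✓`two_pi_abs_q_le`) that the T³ supplier needs to bound the
constant flux part `2πq/M_{s'}²` by `φ₀`. [cite: Balaban1987RG1, (0.4)+(0.11) p.253; Balaban1985Averaging, (9)+(14) p.19] -/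
theorem exists_flux_combine₂ {e₀ e₁ e₂ : Fin P.d} (h01 : e₀ ≠ e₁) (h02 : e₀ ≠ e₂) (h12 : e₁ ≠ e₂) (hall : ∀ κ : Fin P.d, κ = e₀ ∨ κ = e₁ ∨ κ = e₂)
    (k : ℕ) (hk : k ≤ P.m + P.K) (θ : PBond P k → ℝ) (m : Site P k → Fin P.d → Fin P.d → ℤ) {φ₀ : ℝ} (hφ : 6 * φ₀ < 2 * Real.pi)
    (hnear : ∀ (y : Site P k) (μ ν : Fin P.d), |curlAt θ y μ ν - 2 * Real.pi * m y μ ν| ≤ φ₀) :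
    ∃ (s : PBond P k → ℤ) (q : Fin P.d → Fin P.d → ℤ) (a a' : PBond P 0 → ℝ),
      (∀ μ ν, q ν μ = -q μ ν) ∧
      (∀ μ ν, μ ≠ ν → 2 * Real.pi * |(q μ ν : ℝ)| ≤ ((P.sitesPerDir k : ℝ)) ^ 2 * φ₀) ∧
      (linAvgIter k a = fun b => θ b - 2 * Real.pi * s b) ∧
      (∀ (x : Site P 0) (μ ν : Fin P.d), μ ≠ ν → |curlAt a' x μ ν| ≤ (54 : ℝ) ^ P.d * (2 * φ₀) / ((P.L : ℝ) ^ k) ^ 2) ∧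
      (∀ (x : Site P 0) (lam μ ν : Fin P.d), μ ≠ ν → |curlAt a' (x.shift lam) μ ν - curlAt a' x μ ν| ≤ 330 * (54 : ℝ) ^ (P.d - 1) * (2 * φ₀) / ((P.L : ℝ) ^ k) ^ 3) ∧
      (∀ s', s' ≤ k → ∀ (x : Site P s') (μ ν : Fin P.d), curlAt (linAvgIter s' a) x μ ν =
        curlAt (linAvgIter s' a') x μ ν - 2 * Real.pi * q μ ν * (((P.L : ℝ) ^ 2) ^ s' * (1 / ((P.sitesPerDir 0 : ℝ)) ^ 2))
          + 2 * Real.pi * q μ ν * (if x μ = -1 ∧ x ν = -1 then 1 else 0)) := by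
  have hπ := Real.pi_pos
  -- the integer part is an antisymmetric cocycle
  have hanti : ∀ x μ ν, m x ν μ = -m x μ ν := fun x μ ν => by
    have := int_antisymm_of_near_curl θ m (by linarith) x μ ν (hnear x μ ν) (hnear x ν μ); linarith
  have hcube : ∀ x μ ν lam, (m x μ ν - m (x.shift lam) μ ν) + (m x ν lam - m (x.shift μ) ν lam) + (m x lam μ - m (x.shift ν) lam μ) = 0 :=
    fun x μ ν lam => int_cube_of_near_curl θ m hφ x μ ν lam (hnear _ _ _) (hnear _ _ _) (hnear _ _ _) (hnear _ _ _) (hnear _ _ _) (hnear _ _ _)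
  -- ZCLASS
  obtain ⟨q, s, hqanti, hdec⟩ := exists_int_class_decomposition₃ h01 h02 h12 hall m hanti hcube
  -- the three flux cochains with real charges `2π q`
  set r : Fin P.d → Fin P.d → ℝ := fun μ ν => 2 * Real.pi * (q μ ν : ℝ) with hr
  have hrant : ∀ μ ν, r ν μ = -r μ ν := fun μ ν => by simp only [hr, hqanti μ ν, Int.cast_neg]; ring
  obtain ⟨w₀₁, hw₀₁⟩ := exists_fluxLift_real k hk h01 (r e₀ e₁)
  obtain ⟨w₀₂, hw₀₂⟩ := exists_fluxLift_real k hk h02 (r e₀ e₂)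
  obtain ⟨w₁₂, hw₁₂⟩ := exists_fluxLift_real k hk h12 (r e₁ e₂)
  set ws : PBond P 0 → ℝ := fun b => w₀₁ b + w₀₂ b + w₁₂ b with hws
  have hwsIter : ∀ s', linAvgIter s' ws = fun b => linAvgIter s' w₀₁ b + linAvgIter s' w₀₂ b + linAvgIter s' w₁₂ b := by
    intro s'
    rw [hws, show (fun b => w₀₁ b + w₀₂ b + w₁₂ b) = (fun b => (fun b' => w₀₁ b' + w₀₂ b') b + w₁₂ b) from rfl, linAvgIter_add', linAvgIter_add']
  have hwscurl : ∀ s', s' ≤ k → ∀ (x : Site P s') (μ ν : Fin P.d), curlAt (linAvgIter s' ws) x μ ν =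
      r μ ν * (((P.L : ℝ) ^ 2) ^ s' * (1 / ((P.sitesPerDir 0 : ℝ)) ^ 2)) - r μ ν * (if x μ = -1 ∧ x ν = -1 then 1 else 0) := by
    intro s' hs' x μ ν
    rw [hwsIter]
    exact curl_fluxSum h01 h02 h12 hall r hrant _ _ _ _ (hw₀₁ s' hs') (hw₀₂ s' hs') (hw₁₂ s' hs') x μ ν
  -- the de-fluxed coarse angles `θ′ := θ − 2πs + W`
  set sR : PBond P k → ℝ := fun b => 2 * Real.pi * (s b : ℝ) with hsR
  set θ' : PBond P k → ℝ := fun b => θ b - sR b + linAvgIter k ws b with hθ'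
  have hcurlθ' : ∀ (y : Site P k) (μ ν : Fin P.d), curlAt θ' y μ ν =
      (curlAt θ y μ ν - 2 * Real.pi * m y μ ν) + r μ ν * (((P.L : ℝ) ^ 2) ^ k * (1 / ((P.sitesPerDir 0 : ℝ)) ^ 2)) := by
    intro y μ ν
    have e1 : curlAt θ' y μ ν = curlAt θ y μ ν - curlAt sR y μ ν + curlAt (linAvgIter k ws) y μ ν := by simp only [hθ', curlAt]; ring
    have e2 : curlAt sR y μ ν = 2 * Real.pi * ((s ⟨y, μ⟩ : ℝ) + s ⟨y.shift μ, ν⟩ - s ⟨y.shift ν, μ⟩ - s ⟨y, ν⟩) := by simp only [hsR, curlAt]; ring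
    have e3 : (m y μ ν : ℝ) = q μ ν * (if y μ = -1 ∧ y ν = -1 then 1 else 0) + ((s ⟨y, μ⟩ : ℝ) + s ⟨y.shift μ, ν⟩ - s ⟨y.shift ν, μ⟩ - s ⟨y, ν⟩) := by
      have := hdec y μ ν; exact_mod_cast this
    rw [e1, e2, hwscurl k le_rfl, e3]; simp only [hr]; ring
  -- smallness of the class and of `curl θ′`
  have hq : ∀ μ ν, μ ≠ ν → |r μ ν * (((P.L : ℝ) ^ 2) ^ k * (1 / ((P.sitesPerDir 0 : ℝ)) ^ 2))| ≤ φ₀ := by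
    intro μ ν hμν
    have hb := two_pi_abs_q_le θ m hnear hμν (q μ ν) s (fun y => by have := hdec y μ ν; exact_mod_cast this)
    rw [pow_mul_inv_sq k hk]
    have hN : (0 : ℝ) < (P.sitesPerDir k : ℝ) := by exact_mod_cast (by have := P.one_lt_sitesPerDir k; omega)
    rw [abs_mul, abs_of_pos (by positivity : (0:ℝ) < 1 / ((P.sitesPerDir k : ℝ)) ^ 2), hr]
    simp only
    rw [abs_mul (2 * Real.pi) ((q μ ν : ℤ) : ℝ), abs_of_pos (by positivity : (0:ℝ) < 2 * Real.pi)]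
    rw [mul_one_div, div_le_iff₀ (by positivity)]
    linarith
  have hθ'small : ∀ (y : Site P k) (μ ν : Fin P.d), μ ≠ ν → |curlAt θ' y μ ν| ≤ 2 * φ₀ := by
    intro y μ ν hμν
    rw [hcurlθ']
    calc _ ≤ |curlAt θ y μ ν - 2 * Real.pi * m y μ ν| + |r μ ν * (((P.L : ℝ) ^ 2) ^ k * (1 / ((P.sitesPerDir 0 : ℝ)) ^ 2))| := abs_add_le _ _
      _ ≤ φ₀ + φ₀ := add_le_add (hnear y μ ν) (hq μ ν hμν)
      _ = 2 * φ₀ := by ring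
  -- the smooth exact lift of `θ′`
  obtain ⟨a', ha'avg, ha'1, ha'2⟩ := exists_smoothExactLift_torus k hk θ' hθ'small
  refine ⟨s, q, fun b => a' b - ws b, a', hqanti, fun μ ν hμν => two_pi_abs_q_le θ m hnear hμν (q μ ν) s (fun y => by have := hdec y μ ν; exact_mod_cast this), ?_, ha'1, ha'2, ?_⟩
  · -- (E) the exact average
    have h := linAvgIter_sub a' ws k
    have e : (a' - ws : PBond P 0 → ℝ) = fun b => a' b - ws b := by funext b; rfl
    rw [e] at h
    rw [h, ha'avg]
    funext b
    simp only [Pi.sub_apply, hθ', hsR]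
    ring
  · -- (F) the level-wise curl structure
    intro s' hs' x μ ν
    have h := linAvgIter_sub a' ws s'
    have e : (a' - ws : PBond P 0 → ℝ) = fun b => a' b - ws b := by funext b; rfl
    rw [e] at h
    rw [h, curlAt_sub, hwscurl s' hs']
    simp only [hr]
    ring

end Summit.QuantumFields.YangMills.Theorems.LinearLiftFlux

end
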